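import Literature.NumberTheory.Sieve.MaynardNFMainTerm
import Literature.NumberTheory.Sieve.MaynardNFCounting
import Literature.NumberTheory.Sieve.MaynardNFJunk
import Literature.NumberTheory.Sieve.MaynardSieveLemma62
import HarnessLib

/-!
# The Maynard–Tao sieve over `𝓞_K`: the diagonal sum of `S₁` (Maynard's (6.4)–(6.7) over `𝓞_K`)

Topic `Literature/NumberTheory/Sieve`. A. Castillo, C. Hall, R. J. Lemke Oliver, P. Pollack,
L. Thompson, *Bounded gaps between primes in number fields and function fields*, Proc. AMS 143 (2015)
= arXiv:1403.5808, proof of Proposition 2.1 ("the proof of this result follows from exactly the same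
reasoning as Maynard's proofs of Lemmas 6.1 and 6.2"): with the smooth choice
`y_𝔯 = F(log N𝔯₁/log R, …, log N𝔯_k/log R)` on good tuples (`F = 1_{R_k} G`, `G` continuous),
`∑_{𝔯 good} y_𝔯²/∏φ(𝔯ᵢ) = (c_K φ(𝔴)/N𝔴 · log R)^k (I_k(F) + o(1))`
along any choice of the parameters `𝔴 = 𝔴(N)`, `D₀ = D₀(N) → ∞` (every prime of norm `≤ D₀`
dividing `𝔴`), `R = R(N) → ∞` for which the relative error `D₀^{-1/4} N𝔴/φ(𝔴)` of the sharp
one-dimensional sieve sum and the ratio `(1 + ∑_{𝔢∣𝔴}(1 + log N𝔢)/N𝔢)/((φ(𝔴)/N𝔴) log R)` tend to `0`.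
Everything here is PROVED: (6.5) is `MaynardNFJunk.sum_prod_inv_idealTotient_not_isGood_le` with the
prime tail `∑_{N𝔭 > D₀} 1/φ(𝔭)² ≤ 4 D₀^{-1/2} ∑_𝔭 N𝔭^{-3/2}`, and (6.6)–(6.7) is the main-term
evaluation `MaynardNFMainTerm.abs_sum_piFinset_G1_sub_integral_le` combined with the uniform
continuity of `G²` on `[0,1]^k` (the real-variable bookkeeping `MaynardSieve.bracket_le` of the tree's
ℤ-version is reused verbatim).

* `filter_piFinset_isGood_eq`, `sum_piFinset_sub_sum_boxG` — good tuples inside the coordinatewise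
  good ones; `abs_sum_bad_le` — the bad tuples; `sum_primes_inv_idealTotient_sq_le` — the prime tail;
* **`diag_isLittleO`** — the `o(1)` statement above.

## References

* Castillo–Hall–Lemke Oliver–Pollack–Thompson, arXiv:1403.5808, proof of Proposition 2.1.
  [CastilloEtAl2015]
* J. Maynard, *Small gaps between primes*, Ann. of Math. 181 (2015), proof of Lemma 6.2,
  (6.4)–(6.7). [MaynardAnnals2015]
-/

noncomputable section

open Finset Filter Topology Asymptotics UniqueFactorizationMonoid NumberField MeasureTheory
  IsDedekindDomain
open scoped NumberField Classical

namespace Literature.NumberTheory.Sieve.MaynardNF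

open Literature.NumberTheory.LFunctions Literature.NumberTheory.LFunctions.NumberField
  Literature.NumberTheory.Sieve.MaynardTao Literature.NumberTheory.Sieve.IdealSieve

variable {K : Type*} [Field K] [NumberField K]
variable {k : ℕ}

/-! ### Good tuples among the coordinatewise good tuples -/

/-- The good tuples of the box are the good tuples among the coordinatewise good ones. [folklore] -/
theorem filter_piFinset_isGood_eq (𝔴 : Ideal (𝓞 K)) (R : ℝ) :
    (Fintype.piFinset fun _ : Fin k => G1 K 𝔴 R).filter (IsGood 𝔴) = boxG K k 𝔴 R := by
  ext 𝔲
  simp only [Finset.mem_filter, Fintype.mem_piFinset, mem_boxG, mem_box_iff]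
  constructor
  · rintro ⟨h, hg⟩
    exact ⟨fun i => (mem_G1.1 (h i)).1, hg⟩
  · rintro ⟨h, hg⟩
    exact ⟨fun i => mem_G1.2 ⟨h i, hg.squarefree_apply i, hg.sup_eq_top_apply i⟩, hg⟩

/-- **Display (6.5) over `𝓞_K`**: the sum over coordinatewise good tuples minus the sum over good
tuples is the sum over the bad tuples. [cite: MaynardAnnals2015, proof of Lemma 6.2, (6.5)] -/
theorem sum_piFinset_sub_sum_boxG (𝔴 : Ideal (𝓞 K)) (R : ℝ) (w : (Fin k → Ideal (𝓞 K)) → ℝ) :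
    ∑ 𝔲 ∈ Fintype.piFinset (fun _ : Fin k => G1 K 𝔴 R), w 𝔲 - ∑ 𝔲 ∈ boxG K k 𝔴 R, w 𝔲 =
      ∑ 𝔲 ∈ (Fintype.piFinset fun _ : Fin k => G1 K 𝔴 R).filter (fun 𝔲 => ¬IsGood 𝔴 𝔲), w 𝔲 := by
  rw [← filter_piFinset_isGood_eq 𝔴 R, ← Finset.sum_filter_add_sum_filter_not
    (Fintype.piFinset fun _ : Fin k => G1 K 𝔴 R) (IsGood 𝔴) w]
  ring

/-- The sum over the bad tuples is small:
`|∑_bad (∏ 1/φ(𝔲ᵢ)) H(x_𝔲)| ≤ H_max k² L^k ∑_{𝔭 ∤ 𝔴, N𝔭 ≤ R} 1/φ(𝔭)²`.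
[cite: MaynardAnnals2015, proof of Lemma 6.2, (6.5)] -/
theorem abs_sum_bad_le (𝔴 : Ideal (𝓞 K)) (R : ℝ) {H : (Fin k → ℝ) → ℝ} {Hmax : ℝ}
    (hH : ∀ t, |H t| ≤ Hmax) :
    |∑ 𝔲 ∈ (Fintype.piFinset fun _ : Fin k => G1 K 𝔴 R).filter (fun 𝔲 => ¬IsGood 𝔴 𝔲),
        (∏ i, 1 / idealTotient K (𝔲 i)) *
          H (fun i => Real.log (Ideal.absNorm (𝔲 i)) / Real.log R)| ≤
      Hmax * ((k : ℝ) ^ 2 * (∑ 𝔞 ∈ G1 K 𝔴 R, 1 / idealTotient K 𝔞) ^ k *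
        ∑ P ∈ ((finite_primeIdealsLE K R).toFinset).filter (fun P => ¬ P ∣ 𝔴),
          1 / idealTotient K P ^ 2) := by
  have hH0 : 0 ≤ Hmax := (abs_nonneg _).trans (hH 0)
  refine (Finset.abs_sum_le_sum_abs _ _).trans ?_
  calc ∑ 𝔲 ∈ (Fintype.piFinset fun _ : Fin k => G1 K 𝔴 R).filter (fun 𝔲 => ¬IsGood 𝔴 𝔲),
        |(∏ i, 1 / idealTotient K (𝔲 i)) * H (fun i => Real.log (Ideal.absNorm (𝔲 i)) / Real.log R)|
      ≤ ∑ 𝔲 ∈ (Fintype.piFinset fun _ : Fin k => G1 K 𝔴 R).filter (fun 𝔲 => ¬IsGood 𝔴 𝔲),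
        (∏ i, 1 / idealTotient K (𝔲 i)) * Hmax := by
        refine Finset.sum_le_sum fun 𝔲 hu => ?_
        have hP : 0 ≤ ∏ i, 1 / idealTotient K (𝔲 i) := Finset.prod_nonneg fun i _ =>
          (one_div_pos.2 (idealTotient_pos
            (mem_G1.1 (Fintype.mem_piFinset.1 (Finset.mem_filter.1 hu).1 i)).1.1)).le
        rw [abs_mul, abs_of_nonneg hP]
        exact mul_le_mul_of_nonneg_left (hH _) hP
    _ = Hmax * ∑ 𝔲 ∈ (Fintype.piFinset fun _ : Fin k => G1 K 𝔴 R).filter (fun 𝔲 => ¬IsGood 𝔴 𝔲),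
        ∏ i, 1 / idealTotient K (𝔲 i) := by rw [← Finset.sum_mul, mul_comm]
    _ ≤ _ := mul_le_mul_of_nonneg_left (sum_prod_inv_idealTotient_not_isGood_le 𝔴 R) hH0

/-- **The prime tail**: if every prime of norm `≤ D₀` divides `𝔴` (`D₀ ≥ 1`), then
`∑_{𝔭 ∤ 𝔴, N𝔭 ≤ R} 1/φ(𝔭)² ≤ 4 D₀^{-1/2} ∑_𝔭 N𝔭^{-3/2}` (`φ(𝔭) = N𝔭 − 1 ≥ N𝔭/2`, `N𝔭 > D₀`).
[cite: MaynardAnnals2015, proof of Lemma 6.2, (6.5) (the primes p > D₀)] -/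
theorem sum_primes_inv_idealTotient_sq_le {𝔴 : Ideal (𝓞 K)} {D₀ : ℝ} (hD₀ : 1 ≤ D₀)
    (hD : ∀ P : Ideal (𝓞 K), Prime P → (Ideal.absNorm P : ℝ) ≤ D₀ → P ∣ 𝔴) (R : ℝ) :
    ∑ P ∈ ((finite_primeIdealsLE K R).toFinset).filter (fun P => ¬ P ∣ 𝔴), 1 / idealTotient K P ^ 2 ≤
      4 * D₀ ^ (-(1 : ℝ) / 2) *
        ∑' v : HeightOneSpectrum (𝓞 K), (Ideal.absNorm v.asIdeal : ℝ) ^ (-(3 : ℝ) / 2) := by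
  have hZsum : Summable fun v : HeightOneSpectrum (𝓞 K) =>
      (Ideal.absNorm v.asIdeal : ℝ) ^ (-(3 : ℝ) / 2) := by
    have := summable_absNorm_rpow_neg (K := K) (s := 3 / 2) (by norm_num)
    refine this.congr fun v => ?_
    norm_num
  have hpt : ∀ P ∈ ((finite_primeIdealsLE K R).toFinset).filter (fun P => ¬ P ∣ 𝔴),
      1 / idealTotient K P ^ 2 ≤ 4 * D₀ ^ (-(1 : ℝ) / 2) * (Ideal.absNorm P : ℝ) ^ (-(3 : ℝ) / 2) := by
    intro P hP
    rw [Finset.mem_filter] at hP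
    have hP2 : (2 : ℝ) ≤ Ideal.absNorm P := two_le_absNorm_of_mem_primeIdealsLE hP.1
    have hmem := hP.1
    rw [Set.Finite.mem_toFinset] at hmem
    have hPprime : Prime P := Ideal.prime_of_isPrime hmem.2.1 hmem.1
    have hDP : D₀ < Ideal.absNorm P := lt_of_not_ge fun h => hP.2 (hD P hPprime h)
    have hNP0 : (0 : ℝ) < Ideal.absNorm P := by linarith
    have hφ : idealTotient K P = (Ideal.absNorm P : ℝ) - 1 := by
      rw [idealTotient, normalizedFactors_irreducible hPprime.irreducible, normalize_eq,
        Multiset.toFinset_singleton, Finset.prod_singleton]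
      field_simp
    rw [hφ]
    -- `1/(NP − 1)² ≤ 4/NP² = 4 NP^{-1/2} NP^{-3/2} ≤ 4 D₀^{-1/2} NP^{-3/2}`
    have h1 : 1 / ((Ideal.absNorm P : ℝ) - 1) ^ 2 ≤ 4 / (Ideal.absNorm P : ℝ) ^ 2 := by
      rw [div_le_div_iff₀ (by nlinarith) (by positivity)]
      nlinarith
    have h2 : (4 : ℝ) / (Ideal.absNorm P : ℝ) ^ 2 =
        4 * ((Ideal.absNorm P : ℝ) ^ (-(1 : ℝ) / 2) * (Ideal.absNorm P : ℝ) ^ (-(3 : ℝ) / 2)) := by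
      rw [← Real.rpow_add hNP0, show (-(1 : ℝ) / 2 + -(3 : ℝ) / 2) = -((2 : ℕ) : ℝ) by norm_num,
        Real.rpow_neg hNP0.le, Real.rpow_natCast, div_eq_mul_inv]
    have h3 : (Ideal.absNorm P : ℝ) ^ (-(1 : ℝ) / 2) ≤ D₀ ^ (-(1 : ℝ) / 2) :=
      Real.rpow_le_rpow_of_nonpos (by linarith) hDP.le (by norm_num)
    calc 1 / ((Ideal.absNorm P : ℝ) - 1) ^ 2 ≤ 4 / (Ideal.absNorm P : ℝ) ^ 2 := h1
      _ = 4 * ((Ideal.absNorm P : ℝ) ^ (-(1 : ℝ) / 2) * (Ideal.absNorm P : ℝ) ^ (-(3 : ℝ) / 2)) := h2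
      _ ≤ 4 * (D₀ ^ (-(1 : ℝ) / 2) * (Ideal.absNorm P : ℝ) ^ (-(3 : ℝ) / 2)) := by gcongr
      _ = _ := by ring
  refine (Finset.sum_le_sum hpt).trans ?_
  rw [← Finset.mul_sum]
  refine mul_le_mul_of_nonneg_left ?_ (by positivity)
  calc ∑ P ∈ ((finite_primeIdealsLE K R).toFinset).filter (fun P => ¬ P ∣ 𝔴),
        (Ideal.absNorm P : ℝ) ^ (-(3 : ℝ) / 2)
      ≤ ∑ P ∈ (finite_primeIdealsLE K R).toFinset, (Ideal.absNorm P : ℝ) ^ (-(3 : ℝ) / 2) :=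
        Finset.sum_le_sum_of_subset_of_nonneg (Finset.filter_subset _ _) fun _ _ _ => by positivity
    _ ≤ _ := sum_primeIdealsLE_le_tsum (g := fun P => (Ideal.absNorm P : ℝ) ^ (-(3 : ℝ) / 2))
        (fun P => by positivity) hZsum R

/-- Bounding the divisor sum `E_C(𝔴) = ∑_{𝔢∣𝔴}(C + c log N𝔢)/N𝔢` by the constant-free one. [folklore] -/
theorem divisorSum_le (C c : ℝ) {𝔴 : Ideal (𝓞 K)} (h𝔴 : 𝔴 ≠ ⊥) :
    ∑ 𝔢 ∈ idealDivisors K 𝔴, (C + c * Real.log (Ideal.absNorm 𝔢)) / Ideal.absNorm 𝔢 ≤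
      max C c * ∑ 𝔢 ∈ idealDivisors K 𝔴, (1 + Real.log (Ideal.absNorm 𝔢)) / Ideal.absNorm 𝔢 := by
  rw [Finset.mul_sum]
  refine Finset.sum_le_sum fun 𝔢 h𝔢 => ?_
  have hN1 : (1 : ℝ) ≤ Ideal.absNorm 𝔢 := by
    exact_mod_cast Nat.one_le_iff_ne_zero.2 (by
      rw [Ne, Ideal.absNorm_eq_zero_iff]; exact ne_bot_of_mem_idealDivisors h𝔴 h𝔢)
  have hlog : 0 ≤ Real.log (Ideal.absNorm 𝔢 : ℝ) := Real.log_nonneg hN1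
  rw [← mul_div_assoc]
  refine div_le_div_of_nonneg_right ?_ (by linarith)
  rw [mul_add, mul_one]
  exact add_le_add (le_max_left _ _) (mul_le_mul_of_nonneg_right (le_max_right _ _) hlog)

/-! ### Real-variable bookkeeping -/

/-- `L ≤ 3P` from the sharp one-dimensional estimate at `x = R`: the error
`e^{5Z}(E_C + 4c_K + c_K D₀^{-1/4} log R)` is `E + ε P ≤ 2P`. [folklore] -/
theorem L_le_three_mul {L ρ d g E5 EC Dq ε P E : ℝ} (hP : P = ρ * d * g) (hE : E = E5 * (EC + 4 * ρ))
    (hεd : E5 * Dq = ε * d) (hε1 : ε ≤ 1) (hEP : E ≤ P) (hX0 : 0 ≤ ρ * d * g)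
    (h' : L - ρ * d * g ≤ E5 * (EC + 4 * ρ + ρ * Dq * g)) : L ≤ 3 * P := by
  have h1 : E5 * (EC + 4 * ρ + ρ * Dq * g) = E + ε * (ρ * d * g) := by
    calc E5 * (EC + 4 * ρ + ρ * Dq * g) = E5 * (EC + 4 * ρ) + ρ * g * (E5 * Dq) := by ring
      _ = _ := by rw [hεd, hE]; ring
  have h2 : ε * (ρ * d * g) ≤ 1 * (ρ * d * g) := mul_le_mul_of_nonneg_right hε1 hX0
  rw [h1] at h'
  rw [hP] at hEP ⊢
  linarith

/-- `E ≤ t P` from `K_c/c_K · (1 + Σ)/(d log R) ≤ t` (`E = e^{5Z}(E_C + 4c_K) ≤ K_c (1 + Σ)`,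
`K_c = e^{5Z}(max(C, c_K) + 4c_K)`, `P = c_K d log R`). [folklore] -/
theorem E_le_mul_of {E E5 EC ρ C Sg Kc d g P t : ℝ} (hE : E = E5 * (EC + 4 * ρ)) (hE5 : 0 ≤ E5)
    (hρ : 0 < ρ) (hC : 0 ≤ C) (hSg : 0 ≤ Sg) (hECle : EC ≤ max C ρ * Sg)
    (hKc : Kc = E5 * (max C ρ + 4 * ρ)) (hP : P = ρ * d * g) (hd : 0 < d) (hg : 0 < g)
    (h : Kc / ρ * ((1 + Sg) / (d * g)) ≤ t) : E ≤ t * P := by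
  have hm0 : 0 ≤ max C ρ := le_max_of_le_left hC
  have h1 : EC + 4 * ρ ≤ (max C ρ + 4 * ρ) * (1 + Sg) := by
    have hx : (max C ρ + 4 * ρ) * (1 + Sg) = max C ρ * Sg + 4 * ρ + (max C ρ + 4 * ρ * Sg) := by ring
    have hy : 0 ≤ max C ρ + 4 * ρ * Sg := by positivity
    rw [hx]
    linarith only [hECle, hy]
  have hEKc : E ≤ Kc * (1 + Sg) := by
    calc E = E5 * (EC + 4 * ρ) := hE
      _ ≤ E5 * ((max C ρ + 4 * ρ) * (1 + Sg)) := mul_le_mul_of_nonneg_left h1 hE5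
      _ = Kc * (1 + Sg) := by rw [hKc]; ring
  rw [div_mul_div_comm, div_le_iff₀ (by positivity)] at h
  calc E ≤ Kc * (1 + Sg) := hEKc
    _ ≤ t * (ρ * (d * g)) := h
    _ = t * P := by rw [hP]; ring

/-- The two smallness conditions on `η` used by `MaynardSieve.bracket_le`, from `η ≤ η₀` and
`A η₀ ≤ ε₁/8` with `A = H k 2^{k−1} + k 2^{k−1} + 1`. [folklore] -/
theorem eta_bounds {η η₀ A H ε₁ : ℝ} (hH : 0 ≤ H) (hηle : η ≤ η₀) (hη₀0 : 0 ≤ η₀)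
    (hA : A = H * k * 2 ^ (k - 1) + k * 2 ^ (k - 1) + 1) (hη₀A : A * η₀ ≤ ε₁ / 8) (hε₁1 : ε₁ ≤ 1) :
    H * ((k : ℝ) * η * 2 ^ (k - 1)) ≤ ε₁ / 8 ∧ (k : ℝ) * η * 2 ^ (k - 1) ≤ 1 / 8 := by
  have hk2 : (0 : ℝ) ≤ (k : ℝ) * 2 ^ (k - 1) := by positivity
  have hHk2 : (0 : ℝ) ≤ H * (k : ℝ) * 2 ^ (k - 1) := by positivity
  have h1 : (k : ℝ) * 2 ^ (k - 1) * η₀ ≤ A * η₀ := by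
    refine mul_le_mul_of_nonneg_right ?_ hη₀0
    rw [hA]; linarith
  have h2 : H * (k : ℝ) * 2 ^ (k - 1) * η₀ ≤ A * η₀ := by
    refine mul_le_mul_of_nonneg_right ?_ hη₀0
    rw [hA]; linarith
  constructor
  · calc H * ((k : ℝ) * η * 2 ^ (k - 1)) = H * (k : ℝ) * 2 ^ (k - 1) * η := by ring
      _ ≤ H * (k : ℝ) * 2 ^ (k - 1) * η₀ := mul_le_mul_of_nonneg_left hηle hHk2
      _ ≤ A * η₀ := h2
      _ ≤ ε₁ / 8 := hη₀A
  · calc (k : ℝ) * η * 2 ^ (k - 1) = (k : ℝ) * 2 ^ (k - 1) * η := by ring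
      _ ≤ (k : ℝ) * 2 ^ (k - 1) * η₀ := mul_le_mul_of_nonneg_left hηle hk2
      _ ≤ A * η₀ := h1
      _ ≤ ε₁ / 8 := hη₀A
      _ ≤ 1 / 8 := by linarith

/-- **`L ≤ 3 c_K d log R` at fixed parameters**: with `t ≤ 1` bounding both
`e^{5Z} D₀^{-1/4}/d` and `(K_c/c_K)(1 + ∑_{𝔢∣𝔴}(1 + log N𝔢)/N𝔢)/(d log R)`, the sharp one-dimensional
estimate gives `∑_{𝔞 ∈ G1} 1/φ(𝔞) ≤ 3 c_K d log R` (`d = ∑_{𝔢∣𝔴} μ(𝔢)/N𝔢`).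
[cite: CastilloEtAl2015, proof of Proposition 2.1; MaynardAnnals2015, proof of Lemma 6.2, (6.7)] -/
theorem sum_G1_inv_idealTotient_le_three_mul {C Z : ℝ} (hC0 : 0 ≤ C)
    (hsharp : ∀ (𝔴 : Ideal (𝓞 K)), 𝔴 ≠ ⊥ → ∀ D₀ : ℝ, 1 ≤ D₀ →
      (∀ P : Ideal (𝓞 K), Prime P → (Ideal.absNorm P : ℝ) ≤ D₀ → P ∣ 𝔴) → ∀ x : ℝ, 1 ≤ x →
      |∑ 𝔲 ∈ (idealsLE K x).filter (fun 𝔲 => 𝔲 ⊔ 𝔴 = ⊤ ∧ Squarefree 𝔲),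
          ∏ P ∈ (normalizedFactors 𝔲).toFinset, 1 / ((Ideal.absNorm P : ℝ) - 1) -
          dedekindZeta_residue K *
            (∑ 𝔢 ∈ idealDivisors K 𝔴, (idealMoebius 𝔢 : ℝ) / Ideal.absNorm 𝔢) * Real.log x| ≤
        Real.exp (5 * Z) *
          ((∑ 𝔢 ∈ idealDivisors K 𝔴,
              (C + dedekindZeta_residue K * Real.log (Ideal.absNorm 𝔢)) / Ideal.absNorm 𝔢) +
            4 * dedekindZeta_residue K +
            dedekindZeta_residue K * D₀ ^ (-(1 : ℝ) / 4) * Real.log x))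
    {𝔴 : Ideal (𝓞 K)} (h𝔴 : 𝔴 ≠ ⊥) {D₀ : ℝ} (hD₀1 : 1 ≤ D₀)
    (hD : ∀ P : Ideal (𝓞 K), Prime P → (Ideal.absNorm P : ℝ) ≤ D₀ → P ∣ 𝔴)
    {R : ℝ} (hR1 : 1 < R) {Kc t : ℝ} (ht1 : t ≤ 1)
    (hKc : Kc = Real.exp (5 * Z) * (max C (dedekindZeta_residue K) + 4 * dedekindZeta_residue K))
    (hε1 : Real.exp (5 * Z) * (D₀ ^ (-(1 : ℝ) / 4) /
      ∑ 𝔢 ∈ idealDivisors K 𝔴, (idealMoebius 𝔢 : ℝ) / Ideal.absNorm 𝔢) ≤ t)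
    (hE2 : Kc / dedekindZeta_residue K *
      ((1 + ∑ 𝔢 ∈ idealDivisors K 𝔴, (1 + Real.log (Ideal.absNorm 𝔢)) / Ideal.absNorm 𝔢) /
        ((∑ 𝔢 ∈ idealDivisors K 𝔴, (idealMoebius 𝔢 : ℝ) / Ideal.absNorm 𝔢) * Real.log R)) ≤ t) :
    ∑ 𝔞 ∈ G1 K 𝔴 R, 1 / idealTotient K 𝔞 ≤
      3 * (dedekindZeta_residue K *
        (∑ 𝔢 ∈ idealDivisors K 𝔴, (idealMoebius 𝔢 : ℝ) / Ideal.absNorm 𝔢) * Real.log R) := by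
  classical
  have hρ0 : 0 < dedekindZeta_residue K := dedekindZeta_residue_pos K
  have hlogR0 : 0 < Real.log R := Real.log_pos hR1
  obtain ⟨dN, hdNdef⟩ : ∃ x : ℝ, x = ∑ 𝔢 ∈ idealDivisors K 𝔴,
      (idealMoebius 𝔢 : ℝ) / Ideal.absNorm 𝔢 := ⟨_, rfl⟩
  have hdN0 : 0 < dN := by
    rw [hdNdef, dsum_eq_prod_one_sub_inv h𝔴]
    refine Finset.prod_pos fun P hP => ?_
    have h2 : (2 : ℝ) ≤ Ideal.absNorm P := by
      exact_mod_cast two_le_absNorm_of_prime (prime_of_normalized_factor P (Multiset.mem_toFinset.1 hP))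
    have : 1 / (Ideal.absNorm P : ℝ) ≤ 1 / 2 := one_div_le_one_div_of_le (by norm_num) h2
    linarith
  rw [← hdNdef] at hε1 hE2 ⊢
  obtain ⟨P, hP⟩ : ∃ x : ℝ, x = dedekindZeta_residue K * dN * Real.log R := ⟨_, rfl⟩
  have hP0 : 0 < P := by rw [hP]; positivity
  rw [← hP]
  obtain ⟨ε, hεdef⟩ : ∃ x : ℝ, x = Real.exp (5 * Z) * D₀ ^ (-(1 : ℝ) / 4) / dN := ⟨_, rfl⟩
  have hε1' : ε ≤ 1 := by
    have : ε ≤ t := by rw [hεdef, mul_div_assoc]; exact hε1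
    exact this.trans ht1
  have hεd : Real.exp (5 * Z) * D₀ ^ (-(1 : ℝ) / 4) = ε * dN := by rw [hεdef]; field_simp
  obtain ⟨Sg, hSg⟩ : ∃ x : ℝ, x = ∑ 𝔢 ∈ idealDivisors K 𝔴,
      (1 + Real.log (Ideal.absNorm 𝔢)) / Ideal.absNorm 𝔢 := ⟨_, rfl⟩
  rw [← hSg] at hE2
  have hSg0 : 0 ≤ Sg := by
    rw [hSg]
    refine Finset.sum_nonneg fun 𝔢 h𝔢 => ?_
    have hN1 : (1 : ℝ) ≤ Ideal.absNorm 𝔢 := by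
      exact_mod_cast Nat.one_le_iff_ne_zero.2 (by
        rw [Ne, Ideal.absNorm_eq_zero_iff]; exact ne_bot_of_mem_idealDivisors h𝔴 h𝔢)
    have := Real.log_nonneg hN1
    positivity
  obtain ⟨EC, hEC⟩ : ∃ x : ℝ, x = ∑ 𝔢 ∈ idealDivisors K 𝔴,
      (C + dedekindZeta_residue K * Real.log (Ideal.absNorm 𝔢)) / Ideal.absNorm 𝔢 := ⟨_, rfl⟩
  have hECle : EC ≤ max C (dedekindZeta_residue K) * Sg := by
    rw [hEC, hSg]; exact divisorSum_le C (dedekindZeta_residue K) h𝔴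
  obtain ⟨E, hEdef⟩ : ∃ x : ℝ, x = Real.exp (5 * Z) * (EC + 4 * dedekindZeta_residue K) := ⟨_, rfl⟩
  have hEP' : E ≤ t * P :=
    E_le_mul_of hEdef (Real.exp_pos _).le hρ0 hC0 hSg0 hECle hKc hP hdN0 hlogR0 hE2
  have hEP : E ≤ P := hEP'.trans (mul_le_of_le_one_left hP0.le ht1)
  have h := hsharp 𝔴 h𝔴 D₀ hD₀1 hD R hR1.le
  rw [← sum_G1_inv_idealTotient_eq, ← hdNdef, ← hEC] at h
  exact L_le_three_mul hP hEdef hεd hε1' hEP (by positivity) (abs_sub_le_iff.1 h).1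

/-! ### The diagonal sum: `∑_{𝔯 good} F(x_𝔯)²/∏φ(𝔯ᵢ) = (c log R)^k (I_k(F) + o(1))` -/

/-- **The diagonal sum at fixed parameters** (the quantitative core of (6.4)–(6.7) over `𝓞_K`): for
`𝔴 ≠ 0`, `D₀ ≥ 1` with every prime of norm `≤ D₀` dividing `𝔴`, `R > 1`, a mesh `M`, the data
`g, H = 1_{R_k} g` with modulus `ε₁/16` at scale `1/M` and bound `Gmax2`, and the three smallness
conditions `e^{5Z} D₀^{-1/4}/d ≤ η₀/(4M)`, `(K_c/c_K)(1 + Σ_{𝔢∣𝔴}(1+log N𝔢)/N𝔢)/(d log R) ≤ η₀/(4M)`,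
`16 Gmax2 k² 3^k Z₃ D₀^{-1/2} ≤ ε₁`:
`|∑_{𝔯 ∈ boxG} (∏ 1/φ(𝔯ᵢ)) H(x_𝔯) − P^k ∫_{[0,1]^k} H| ≤ (3ε₁/4) P^k`, `P = c_K d log R`.
[cite: CastilloEtAl2015, proof of Proposition 2.1; MaynardAnnals2015, proof of Lemma 6.2, (6.4)–(6.7)] -/
theorem diag_core (hk : 0 < k) {C Z : ℝ} (hC0 : 0 ≤ C)
    (hsharp : ∀ (𝔴 : Ideal (𝓞 K)), 𝔴 ≠ ⊥ → ∀ D₀ : ℝ, 1 ≤ D₀ →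
      (∀ P : Ideal (𝓞 K), Prime P → (Ideal.absNorm P : ℝ) ≤ D₀ → P ∣ 𝔴) → ∀ x : ℝ, 1 ≤ x →
      |∑ 𝔲 ∈ (idealsLE K x).filter (fun 𝔲 => 𝔲 ⊔ 𝔴 = ⊤ ∧ Squarefree 𝔲),
          ∏ P ∈ (normalizedFactors 𝔲).toFinset, 1 / ((Ideal.absNorm P : ℝ) - 1) -
          dedekindZeta_residue K *
            (∑ 𝔢 ∈ idealDivisors K 𝔴, (idealMoebius 𝔢 : ℝ) / Ideal.absNorm 𝔢) * Real.log x| ≤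
        Real.exp (5 * Z) *
          ((∑ 𝔢 ∈ idealDivisors K 𝔴,
              (C + dedekindZeta_residue K * Real.log (Ideal.absNorm 𝔢)) / Ideal.absNorm 𝔢) +
            4 * dedekindZeta_residue K +
            dedekindZeta_residue K * D₀ ^ (-(1 : ℝ) / 4) * Real.log x))
    {𝔴 : Ideal (𝓞 K)} (h𝔴 : 𝔴 ≠ ⊥) {D₀ : ℝ} (hD₀1 : 1 ≤ D₀)
    (hD : ∀ P : Ideal (𝓞 K), Prime P → (Ideal.absNorm P : ℝ) ≤ D₀ → P ∣ 𝔴)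
    {R : ℝ} (hR1 : 1 < R) {M : ℕ} (hMpos : 0 < M)
    {g H : (Fin k → ℝ) → ℝ} {ε₁ Gmax2 η₀ A Z₃ Kc : ℝ} (hε₁0 : 0 < ε₁) (hε₁1 : ε₁ ≤ 1)
    (hH2 : 0 ≤ Gmax2)
    (hcont : ∀ t ∈ maynardCube k, ∀ t' ∈ maynardCube k,
      (∀ i, |t i - t' i| ≤ 1 / (M : ℝ)) → |g t - g t'| ≤ ε₁ / 16)
    (hgb : ∀ t ∈ maynardCube k, |g t| ≤ Gmax2)
    (hint : IntegrableOn
      ((polytope (fun _ : Unit => (Finset.univ : Finset (Fin k)))).indicator g) (maynardCube k) volume)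
    (hHdef : H = (polytope (fun _ : Unit => (Finset.univ : Finset (Fin k)))).indicator g)
    (hHb : ∀ t, |H t| ≤ Gmax2)
    (hq : 2 * Gmax2 * (k + 1 : ℝ) / M ≤ ε₁ / 32)
    (hη₀0 : 0 < η₀) (hη₀1 : η₀ ≤ 1) (hA : A = Gmax2 * k * 2 ^ (k - 1) + k * 2 ^ (k - 1) + 1)
    (hη₀A : A * η₀ ≤ ε₁ / 8)
    (hZ₃ : Z₃ = ∑' v : HeightOneSpectrum (𝓞 K), (Ideal.absNorm v.asIdeal : ℝ) ^ (-(3 : ℝ) / 2))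
    (hKc : Kc = Real.exp (5 * Z) * (max C (dedekindZeta_residue K) + 4 * dedekindZeta_residue K))
    (hε1 : Real.exp (5 * Z) * (D₀ ^ (-(1 : ℝ) / 4) /
      ∑ 𝔢 ∈ idealDivisors K 𝔴, (idealMoebius 𝔢 : ℝ) / Ideal.absNorm 𝔢) ≤ η₀ / (4 * M))
    (hE2 : Kc / dedekindZeta_residue K *
      ((1 + ∑ 𝔢 ∈ idealDivisors K 𝔴, (1 + Real.log (Ideal.absNorm 𝔢)) / Ideal.absNorm 𝔢) /
        ((∑ 𝔢 ∈ idealDivisors K 𝔴, (idealMoebius 𝔢 : ℝ) / Ideal.absNorm 𝔢) * Real.log R)) ≤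
      η₀ / (4 * M))
    (hbad3 : 16 * Gmax2 * (k : ℝ) ^ 2 * 3 ^ k * Z₃ * D₀ ^ (-(1 : ℝ) / 2) ≤ ε₁) :
    |∑ 𝔲 ∈ boxG K k 𝔴 R,
        (∏ i, 1 / idealTotient K (𝔲 i)) * H (fun i => Real.log (Ideal.absNorm (𝔲 i)) / Real.log R) -
        (dedekindZeta_residue K *
            (∑ 𝔢 ∈ idealDivisors K 𝔴, (idealMoebius 𝔢 : ℝ) / Ideal.absNorm 𝔢) * Real.log R) ^ k *
          ∫ t in maynardCube k, H t| ≤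
      3 / 4 * ε₁ * (dedekindZeta_residue K *
        (∑ 𝔢 ∈ idealDivisors K 𝔴, (idealMoebius 𝔢 : ℝ) / Ideal.absNorm 𝔢) * Real.log R) ^ k := by
  classical
  have hρ0 : 0 < dedekindZeta_residue K := dedekindZeta_residue_pos K
  have hM0 : (0 : ℝ) < M := by exact_mod_cast hMpos
  have hM1' : (1 : ℝ) ≤ M := by exact_mod_cast hMpos
  have hηM1 : η₀ / (4 * M) ≤ 1 := by
    rw [div_le_one (by positivity)]; nlinarith
  have hlogR0 : 0 < Real.log R := Real.log_pos hR1
  have hZ₃0 : 0 ≤ Z₃ := by rw [hZ₃]; exact tsum_nonneg fun v => by positivity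
  -- `d`, `c`, `P`, `ε`, `E`
  obtain ⟨dN, hdNdef⟩ : ∃ x : ℝ, x = ∑ 𝔢 ∈ idealDivisors K 𝔴,
      (idealMoebius 𝔢 : ℝ) / Ideal.absNorm 𝔢 := ⟨_, rfl⟩
  have hdN0 : 0 < dN := by
    rw [hdNdef, dsum_eq_prod_one_sub_inv h𝔴]
    refine Finset.prod_pos fun P hP => ?_
    have h2 : (2 : ℝ) ≤ Ideal.absNorm P := by
      exact_mod_cast two_le_absNorm_of_prime (prime_of_normalized_factor P (Multiset.mem_toFinset.1 hP))
    have : 1 / (Ideal.absNorm P : ℝ) ≤ 1 / 2 := one_div_le_one_div_of_le (by norm_num) h2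
    linarith
  rw [← hdNdef] at hε1 hE2 ⊢
  obtain ⟨P, hP⟩ : ∃ x : ℝ, x = dedekindZeta_residue K * dN * Real.log R := ⟨_, rfl⟩
  have hP0 : 0 < P := by rw [hP]; positivity
  have hPeq : dedekindZeta_residue K * dN * Real.log R = P := hP.symm
  rw [hPeq]
  obtain ⟨ε, hεdef⟩ : ∃ x : ℝ, x = Real.exp (5 * Z) * D₀ ^ (-(1 : ℝ) / 4) / dN := ⟨_, rfl⟩
  have hε0 : 0 ≤ ε := by rw [hεdef]; positivity
  have hεle : ε ≤ η₀ / (4 * M) := by rw [hεdef, mul_div_assoc]; exact hε1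
  have hε1' : ε ≤ 1 := hεle.trans hηM1
  have hεd : Real.exp (5 * Z) * D₀ ^ (-(1 : ℝ) / 4) = ε * dN := by rw [hεdef]; field_simp
  obtain ⟨Sg, hSg⟩ : ∃ x : ℝ, x = ∑ 𝔢 ∈ idealDivisors K 𝔴,
      (1 + Real.log (Ideal.absNorm 𝔢)) / Ideal.absNorm 𝔢 := ⟨_, rfl⟩
  rw [← hSg] at hE2
  have hSg0 : 0 ≤ Sg := by
    rw [hSg]
    refine Finset.sum_nonneg fun 𝔢 h𝔢 => ?_
    have hN1 : (1 : ℝ) ≤ Ideal.absNorm 𝔢 := by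
      exact_mod_cast Nat.one_le_iff_ne_zero.2 (by
        rw [Ne, Ideal.absNorm_eq_zero_iff]; exact ne_bot_of_mem_idealDivisors h𝔴 h𝔢)
    have := Real.log_nonneg hN1
    positivity
  obtain ⟨EC, hEC⟩ : ∃ x : ℝ, x = ∑ 𝔢 ∈ idealDivisors K 𝔴,
      (C + dedekindZeta_residue K * Real.log (Ideal.absNorm 𝔢)) / Ideal.absNorm 𝔢 := ⟨_, rfl⟩
  have hECle : EC ≤ max C (dedekindZeta_residue K) * Sg := by
    rw [hEC, hSg]; exact divisorSum_le C (dedekindZeta_residue K) h𝔴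
  obtain ⟨E, hEdef⟩ : ∃ x : ℝ, x = Real.exp (5 * Z) * (EC + 4 * dedekindZeta_residue K) := ⟨_, rfl⟩
  have hE0 : 0 ≤ E := by
    have hEC0 : 0 ≤ EC := by
      rw [hEC]
      refine Finset.sum_nonneg fun 𝔢 h𝔢 => ?_
      have hN1 : (1 : ℝ) ≤ Ideal.absNorm 𝔢 := by
        exact_mod_cast Nat.one_le_iff_ne_zero.2 (by
          rw [Ne, Ideal.absNorm_eq_zero_iff]; exact ne_bot_of_mem_idealDivisors h𝔴 h𝔢)
      have := Real.log_nonneg hN1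
      positivity
    rw [hEdef]; positivity
  have hEP' : E ≤ η₀ / (4 * M) * P :=
    E_le_mul_of hEdef (Real.exp_pos _).le hρ0 hC0 hSg0 hECle hKc hP hdN0 hlogR0 hE2
  have hEP : E ≤ P := hEP'.trans (by nlinarith)
  have hEPdiv : E / P ≤ η₀ / (4 * M) := by rw [div_le_iff₀ hP0]; exact hEP'
  -- `L ≤ 3P`
  obtain ⟨L, hLdef⟩ : ∃ L : ℝ, L = ∑ 𝔞 ∈ G1 K 𝔴 R, 1 / idealTotient K 𝔞 := ⟨_, rfl⟩
  have hL0 : 0 ≤ L := by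
    rw [hLdef]; exact Finset.sum_nonneg fun 𝔞 ha => (one_div_pos.2 (idealTotient_pos (mem_G1.1 ha).1.1)).le
  have hL : L ≤ 3 * P := by
    have h := hsharp 𝔴 h𝔴 D₀ hD₀1 hD R hR1.le
    rw [← sum_G1_inv_idealTotient_eq, ← hLdef, ← hdNdef, ← hEC] at h
    exact L_le_three_mul hP hEdef hεd hε1' hEP (by positivity) (abs_sub_le_iff.1 h).1
  -- (6.5): the bad tuples
  have hbad := abs_sum_bad_le (k := k) 𝔴 R (H := H) hHb
  rw [← hLdef] at hbad
  have htail := sum_primes_inv_idealTotient_sq_le hD₀1 hD R (K := K)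
  rw [← hZ₃] at htail
  have hS0 : 0 ≤ ∑ P ∈ ((finite_primeIdealsLE K R).toFinset).filter (fun P => ¬ P ∣ 𝔴),
      1 / idealTotient K P ^ 2 := Finset.sum_nonneg fun _ _ => by positivity
  have hLk : L ^ k ≤ (3 * P) ^ k := pow_le_pow_left₀ hL0 hL k
  have hbad' : Gmax2 * ((k : ℝ) ^ 2 * L ^ k *
      ∑ P ∈ ((finite_primeIdealsLE K R).toFinset).filter (fun P => ¬ P ∣ 𝔴),
        1 / idealTotient K P ^ 2) ≤ ε₁ / 4 * P ^ k := by
    have h1 : (k : ℝ) ^ 2 * L ^ k *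
        ∑ P ∈ ((finite_primeIdealsLE K R).toFinset).filter (fun P => ¬ P ∣ 𝔴),
          1 / idealTotient K P ^ 2 ≤
        (k : ℝ) ^ 2 * (3 * P) ^ k * (4 * D₀ ^ (-(1 : ℝ) / 2) * Z₃) :=
      mul_le_mul (mul_le_mul_of_nonneg_left hLk (by positivity)) htail hS0 (by positivity)
    have h2 : Gmax2 * ((k : ℝ) ^ 2 * (3 * P) ^ k * (4 * D₀ ^ (-(1 : ℝ) / 2) * Z₃)) =
        (16 * Gmax2 * (k : ℝ) ^ 2 * 3 ^ k * Z₃ * D₀ ^ (-(1 : ℝ) / 2)) / 4 * P ^ k := by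
      rw [mul_pow]; ring
    calc Gmax2 * ((k : ℝ) ^ 2 * L ^ k *
          ∑ P ∈ ((finite_primeIdealsLE K R).toFinset).filter (fun P => ¬ P ∣ 𝔴),
            1 / idealTotient K P ^ 2)
        ≤ Gmax2 * ((k : ℝ) ^ 2 * (3 * P) ^ k * (4 * D₀ ^ (-(1 : ℝ) / 2) * Z₃)) :=
          mul_le_mul_of_nonneg_left h1 hH2
      _ = (16 * Gmax2 * (k : ℝ) ^ 2 * 3 ^ k * Z₃ * D₀ ^ (-(1 : ℝ) / 2)) / 4 * P ^ k := h2
      _ ≤ ε₁ / 4 * P ^ k :=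
          mul_le_mul_of_nonneg_right (div_le_div_of_nonneg_right hbad3 (by norm_num)) (pow_pos hP0 k).le
  -- (6.6)–(6.7): the main-term evaluation
  have hc : dedekindZeta_residue K * dN = dedekindZeta_residue K * dN := rfl
  have hEdef' : E = Real.exp (5 * Z) * ((∑ 𝔢 ∈ idealDivisors K 𝔴,
      (C + dedekindZeta_residue K * Real.log (Ideal.absNorm 𝔢)) / Ideal.absNorm 𝔢) +
        4 * dedekindZeta_residue K) := by rw [hEdef, hEC]
  have hmain := abs_sum_piFinset_G1_sub_integral_le hk hC0 hsharp h𝔴 hD₀1 hD hR1 hMpos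
    (fun _ : Unit => (Finset.univ : Finset (Fin k)))
    (by positivity : (0 : ℝ) ≤ ε₁ / 16) hH2 hcont hgb hint (d := dN) (c := dedekindZeta_residue K * dN)
    (ε := ε) (E := E) hdNdef hc hεdef hEdef'
  have hL' : ∑ _l : Unit, ((Finset.univ : Finset (Fin k)).card + 1 : ℝ) = k + 1 := by simp
  rw [hL', hPeq, ← hHdef] at hmain
  -- `η ≤ η₀`
  obtain ⟨η, hηdef⟩ : ∃ e : ℝ, e = 2 * M * (ε + E / P) := ⟨_, rfl⟩
  rw [← hηdef] at hmain
  have hη0 : 0 ≤ η := by rw [hηdef]; positivity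
  have hηle : η ≤ η₀ := by
    calc η = 2 * M * (ε + E / P) := hηdef
      _ ≤ 2 * M * (η₀ / (4 * M) + η₀ / (4 * M)) :=
          mul_le_mul_of_nonneg_left (add_le_add hεle hEPdiv) (by positivity)
      _ = η₀ := by field_simp; ring
  have hη1 : η ≤ 1 := hηle.trans hη₀1
  obtain ⟨hηk, hηk'⟩ := eta_bounds (k := k) hH2 hηle hη₀0.le hA hη₀A hε₁1
  have hq0 : (0 : ℝ) ≤ 2 * Gmax2 * (k + 1 : ℝ) / M :=
    div_nonneg (mul_nonneg (mul_nonneg zero_le_two hH2) (by positivity)) (Nat.cast_nonneg M)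
  have hbr := MaynardSieve.bracket_le (k := k) (H := Gmax2) (ε := ε₁) hH2 hη0 rfl hq0 hq hηk hηk' hη1
  have hT : |∑ 𝔲 ∈ Fintype.piFinset (fun _ : Fin k => G1 K 𝔴 R),
      (∏ i, 1 / idealTotient K (𝔲 i)) * H (fun i => Real.log (Ideal.absNorm (𝔲 i)) / Real.log R) -
      P ^ k * ∫ t in maynardCube k, H t| ≤
      P ^ k * (ε₁ / 2) :=
    hmain.trans (mul_le_mul_of_nonneg_left hbr (pow_pos hP0 k).le)
  -- assemble
  have hsplit : ∀ (x T s : ℝ), |x - s| ≤ |T - x| + |T - s| := fun x T s => by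
    calc |x - s| = |(T - s) - (T - x)| := by ring_nf
      _ ≤ |T - s| + |T - x| := abs_sub _ _
      _ = _ := add_comm _ _
  refine (hsplit _ (∑ 𝔲 ∈ Fintype.piFinset (fun _ : Fin k => G1 K 𝔴 R),
      (∏ i, 1 / idealTotient K (𝔲 i)) *
        H (fun i => Real.log (Ideal.absNorm (𝔲 i)) / Real.log R)) _).trans ?_
  rw [sum_piFinset_sub_sum_boxG]
  have hfin : ε₁ / 4 * P ^ k + P ^ k * (ε₁ / 2) = 3 / 4 * ε₁ * P ^ k := by ring
  rw [← hfin]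
  exact add_le_add (hbad.trans hbad') hT

/-- **The diagonal sum of `S₁` over `𝓞_K`** (Castillo et al., proof of Proposition 2.1 = Maynard's
(6.4)–(6.7) over `𝓞_K`): along parameters `𝔴(N) ≠ 0`, `D₀(N) → ∞` with every prime of norm
`≤ D₀(N)` dividing `𝔴(N)`, `R(N) → ∞`, such that `D₀^{-1/4}/d → 0` and
`(1 + ∑_{𝔢∣𝔴}(1 + log N𝔢)/N𝔢)/(d log R) → 0` (`d = ∑_{𝔢∣𝔴} μ(𝔢)/N𝔢 = φ(𝔴)/N𝔴`), for continuous
`G` and `F = 1_{R_k} G`: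
`∑_{𝔯 ∈ boxG} F(x_𝔯)²/∏ φ(𝔯ᵢ) − (c_K d log R)^k I_k(F) = o((c_K d log R)^k)`.
[cite: CastilloEtAl2015, proof of Proposition 2.1 (via Lemma 2.5); MaynardAnnals2015, proof of Lemma 6.2, (6.4)–(6.7)] -/
theorem diag_isLittleO (hk : 0 < k) {G : (Fin k → ℝ) → ℝ} (hG : Continuous G)
    {𝔴 : ℝ → Ideal (𝓞 K)} {D₀ R : ℝ → ℝ}
    (h𝔴 : ∀ N, 𝔴 N ≠ ⊥) (hD₀ : Tendsto D₀ atTop atTop)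
    (hD : ∀ N, ∀ P : Ideal (𝓞 K), Prime P → (Ideal.absNorm P : ℝ) ≤ D₀ N → P ∣ 𝔴 N)
    (hR : Tendsto R atTop atTop)
    (hε : Tendsto (fun N => D₀ N ^ (-(1 : ℝ) / 4) /
        ∑ 𝔢 ∈ idealDivisors K (𝔴 N), (idealMoebius 𝔢 : ℝ) / Ideal.absNorm 𝔢) atTop (𝓝 0))
    (hE : Tendsto (fun N =>
        (1 + ∑ 𝔢 ∈ idealDivisors K (𝔴 N), (1 + Real.log (Ideal.absNorm 𝔢)) / Ideal.absNorm 𝔢) /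
          ((∑ 𝔢 ∈ idealDivisors K (𝔴 N), (idealMoebius 𝔢 : ℝ) / Ideal.absNorm 𝔢) *
            Real.log (R N))) atTop (𝓝 0)) :
    (fun N => ∑ 𝔲 ∈ boxG K k (𝔴 N) (R N),
        (maynardSimplex k).indicator G (fun i => Real.log (Ideal.absNorm (𝔲 i)) / Real.log (R N)) ^ 2 /
          ∏ i, idealTotient K (𝔲 i) -
        (dedekindZeta_residue K *
            (∑ 𝔢 ∈ idealDivisors K (𝔴 N), (idealMoebius 𝔢 : ℝ) / Ideal.absNorm 𝔢) *
              Real.log (R N)) ^ k * maynardI k ((maynardSimplex k).indicator G)) =o[atTop]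
      fun N => (dedekindZeta_residue K *
        (∑ 𝔢 ∈ idealDivisors K (𝔴 N), (idealMoebius 𝔢 : ℝ) / Ideal.absNorm 𝔢) * Real.log (R N)) ^ k := by
  classical
  have hcubeK : IsCompact (maynardCube k) := isCompact_univ_pi fun _ => isCompact_Icc
  -- `|G| ≤ Gmax` on the cube, `g = G²`
  obtain ⟨Gmax, hG0, hGmax⟩ : ∃ M : ℝ, 0 ≤ M ∧ ∀ x ∈ maynardCube k, |G x| ≤ M := by
    obtain ⟨M, hM⟩ := hcubeK.exists_bound_of_continuousOn hG.continuousOn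
    exact ⟨max M 0, le_max_right _ _, fun x hx =>
      (Real.norm_eq_abs (G x) ▸ hM x hx).trans (le_max_left _ _)⟩
  obtain ⟨g, hg⟩ : ∃ g : (Fin k → ℝ) → ℝ, g = fun t => G t ^ 2 := ⟨_, rfl⟩
  have hgc : Continuous g := by rw [hg]; exact hG.pow 2
  have hgb : ∀ t ∈ maynardCube k, |g t| ≤ Gmax ^ 2 := fun t ht => by
    rw [hg]; dsimp only; rw [abs_pow]; exact pow_le_pow_left₀ (abs_nonneg _) (hGmax t ht) 2
  have hH2 : 0 ≤ Gmax ^ 2 := by positivity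
  -- the polytope data
  obtain ⟨S, hS⟩ : ∃ S : Unit → Finset (Fin k), S = fun _ => Finset.univ := ⟨_, rfl⟩
  have hPoly : polytope S = maynardSimplex k := by rw [hS]; exact polytope_univ_eq_maynardSimplex k
  obtain ⟨H, hHdef⟩ : ∃ H : (Fin k → ℝ) → ℝ, H = (polytope S).indicator g := ⟨_, rfl⟩
  have hHF : ∀ t, (maynardSimplex k).indicator G t ^ 2 = H t := fun t => by
    rw [hHdef, hg, hS]; exact MaynardSieve.indicator_sq_eq G t
  have hHb : ∀ t, |H t| ≤ Gmax ^ 2 := fun t => by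
    rw [hHdef, hPoly]
    by_cases ht : t ∈ maynardSimplex k
    · rw [Set.indicator_of_mem ht]; exact hgb t (maynardSimplex_subset_maynardCube k ht)
    · rw [Set.indicator_of_notMem ht, abs_zero]; positivity
  have hint : IntegrableOn ((polytope S).indicator g) (maynardCube k) volume := by
    refine (hgc.continuousOn.integrableOn_compact hcubeK).indicator ?_
    rw [hPoly]; exact measurableSet_maynardSimplex k
  have hIint : ∫ t in maynardCube k, (polytope S).indicator g t =
      maynardI k ((maynardSimplex k).indicator G) := by
    rw [hS, hg]; exact MaynardSieve.integral_cube_indicator_sq_eq G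
  -- uniform continuity of `g`
  have huc : UniformContinuousOn g (maynardCube k) :=
    hcubeK.uniformContinuousOn_of_continuous hgc.continuousOn
  -- the constants of the sharp one-dimensional sieve sum and of the prime tail
  obtain ⟨C, Z, hC0, hZ0, hsharp⟩ := abs_sum_inv_totientIdeal_sub_sharp (K := K)
  have hρ0 : 0 < dedekindZeta_residue K := dedekindZeta_residue_pos K
  obtain ⟨Z₃, hZ₃⟩ : ∃ x : ℝ, x = ∑' v : HeightOneSpectrum (𝓞 K),
      (Ideal.absNorm v.asIdeal : ℝ) ^ (-(3 : ℝ) / 2) := ⟨_, rfl⟩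
  obtain ⟨Kc, hKc⟩ : ∃ x : ℝ, x = Real.exp (5 * Z) *
      (max C (dedekindZeta_residue K) + 4 * dedekindZeta_residue K) := ⟨_, rfl⟩
  -- the target
  rw [Asymptotics.isLittleO_iff]
  intro ε₀ hε₀
  obtain ⟨ε₁, hε₁⟩ : ∃ e : ℝ, e = min ε₀ 1 := ⟨_, rfl⟩
  have hε₁0 : 0 < ε₁ := by rw [hε₁]; exact lt_min hε₀ one_pos
  have hε₁1 : ε₁ ≤ 1 := by rw [hε₁]; exact min_le_right _ _
  have hε₁ε : ε₁ ≤ ε₀ := by rw [hε₁]; exact min_le_left _ _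
  -- `ω = ε₁/16` and the mesh `M`
  obtain ⟨δ₁, hδ₁, hδ⟩ := Metric.uniformContinuousOn_iff.1 huc (ε₁ / 16) (by positivity)
  obtain ⟨M, hM1, hM2⟩ : ∃ M : ℕ, 1 / δ₁ < M ∧ 64 * Gmax ^ 2 * (k + 1) / ε₁ ≤ M := by
    refine ⟨⌈max (1 / δ₁) (64 * Gmax ^ 2 * (k + 1) / ε₁)⌉₊ + 1, ?_, ?_⟩
    · calc 1 / δ₁ ≤ max (1 / δ₁) (64 * Gmax ^ 2 * (k + 1) / ε₁) := le_max_left _ _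
        _ ≤ ⌈max (1 / δ₁) (64 * Gmax ^ 2 * (k + 1) / ε₁)⌉₊ := Nat.le_ceil _
        _ < _ := by push_cast; linarith
    · calc 64 * Gmax ^ 2 * (k + 1) / ε₁ ≤ max (1 / δ₁) (64 * Gmax ^ 2 * (k + 1) / ε₁) := le_max_right _ _
        _ ≤ ⌈max (1 / δ₁) (64 * Gmax ^ 2 * (k + 1) / ε₁)⌉₊ := Nat.le_ceil _
        _ ≤ _ := by push_cast; linarith
  have hM0 : (0 : ℝ) < M := lt_of_le_of_lt (by positivity) hM1
  have hMpos : 0 < M := by exact_mod_cast hM0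
  have hcont : ∀ t ∈ maynardCube k, ∀ t' ∈ maynardCube k,
      (∀ i, |t i - t' i| ≤ 1 / (M : ℝ)) → |g t - g t'| ≤ ε₁ / 16 := by
    intro t ht t' ht' hd'
    have h1 : dist t t' ≤ 1 / (M : ℝ) :=
      (dist_pi_le_iff (by positivity)).2 fun i => by rw [Real.dist_eq]; exact hd' i
    have h2 : 1 / (M : ℝ) < δ₁ := by
      rw [div_lt_iff₀ hM0]
      calc (1 : ℝ) = δ₁ * (1 / δ₁) := by field_simp
        _ < δ₁ * M := by gcongr
    have := hδ t ht t' ht' (by linarith)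
    rw [Real.dist_eq] at this
    exact this.le
  have hq : 2 * Gmax ^ 2 * (k + 1 : ℝ) / M ≤ ε₁ / 32 := by
    rw [div_le_iff₀ hM0]
    have := (div_le_iff₀ hε₁0).1 hM2
    linarith
  -- `η₀`
  obtain ⟨A, hA⟩ : ∃ A : ℝ, A = Gmax ^ 2 * k * 2 ^ (k - 1) + k * 2 ^ (k - 1) + 1 := ⟨_, rfl⟩
  have hA0 : 0 < A := by rw [hA]; positivity
  obtain ⟨η₀, hη₀⟩ : ∃ e : ℝ, e = min 1 (ε₁ / (8 * A)) := ⟨_, rfl⟩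
  have hη₀0 : 0 < η₀ := by rw [hη₀]; exact lt_min one_pos (by positivity)
  have hη₀1 : η₀ ≤ 1 := by rw [hη₀]; exact min_le_left _ _
  have hη₀A : A * η₀ ≤ ε₁ / 8 := by
    have : η₀ ≤ ε₁ / (8 * A) := by rw [hη₀]; exact min_le_right _ _
    rw [le_div_iff₀ (by positivity)] at this
    linarith
  have hηM : 0 < η₀ / (4 * M) := by positivity
  -- the eventual smallness of `ε(N)`, `E(N)/(c log R)` and of the prime tail
  have hev1 : ∀ᶠ N in atTop, Real.exp (5 * Z) * (D₀ N ^ (-(1 : ℝ) / 4) /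
      ∑ 𝔢 ∈ idealDivisors K (𝔴 N), (idealMoebius 𝔢 : ℝ) / Ideal.absNorm 𝔢) ≤ η₀ / (4 * M) := by
    have h1 := hε.const_mul (Real.exp (5 * Z))
    rw [mul_zero] at h1
    exact h1.eventually (eventually_le_nhds hηM)
  have hev2 : ∀ᶠ N in atTop, Kc / dedekindZeta_residue K *
      ((1 + ∑ 𝔢 ∈ idealDivisors K (𝔴 N), (1 + Real.log (Ideal.absNorm 𝔢)) / Ideal.absNorm 𝔢) /
        ((∑ 𝔢 ∈ idealDivisors K (𝔴 N), (idealMoebius 𝔢 : ℝ) / Ideal.absNorm 𝔢) * Real.log (R N))) ≤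
      η₀ / (4 * M) := by
    have h1 := hE.const_mul (Kc / dedekindZeta_residue K)
    rw [mul_zero] at h1
    exact h1.eventually (eventually_le_nhds hηM)
  have hev3 : ∀ᶠ N in atTop,
      16 * Gmax ^ 2 * (k : ℝ) ^ 2 * 3 ^ k * Z₃ * D₀ N ^ (-(1 : ℝ) / 2) ≤ ε₁ := by
    have h1 : Tendsto (fun N => 16 * Gmax ^ 2 * (k : ℝ) ^ 2 * 3 ^ k * Z₃ * D₀ N ^ (-(1 / 2 : ℝ)))
        atTop (𝓝 (16 * Gmax ^ 2 * (k : ℝ) ^ 2 * 3 ^ k * Z₃ * 0)) :=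
      ((tendsto_rpow_neg_atTop (by norm_num : (0 : ℝ) < 1 / 2)).comp hD₀).const_mul _
    rw [mul_zero] at h1
    have h2 := h1.eventually (eventually_le_nhds hε₁0)
    filter_upwards [h2] with N hN
    have : (-(1 : ℝ) / 2) = -(1 / 2 : ℝ) := by norm_num
    rw [this]; exact hN
  filter_upwards [hev1, hev2, hev3, hD₀.eventually_ge_atTop 1, hR.eventually_ge_atTop 2]
    with N hε1 hE2 hbad3 hD₀1 hR2
  have hR1 : 1 < R N := by linarith
  have hcore := diag_core hk hC0 hsharp (h𝔴 N) hD₀1 (hD N) hR1 hMpos (g := g) (H := H) hε₁0 hε₁1 hH2 hcont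
    hgb (by rw [← hS]; exact hint) (by rw [hHdef, hS]) hHb hq hη₀0 hη₀1 hA hη₀A hZ₃ hKc hε1 hE2 hbad3
  have hIint' : ∫ t in maynardCube k, H t = maynardI k ((maynardSimplex k).indicator G) := by
    rw [hHdef]; exact hIint
  rw [hIint'] at hcore
  -- positivity of the scale and the conversion `F(x)²/∏φ = (∏ 1/φ) H(x)`
  obtain ⟨P, hP⟩ : ∃ x : ℝ, x = dedekindZeta_residue K *
      (∑ 𝔢 ∈ idealDivisors K (𝔴 N), (idealMoebius 𝔢 : ℝ) / Ideal.absNorm 𝔢) * Real.log (R N) := ⟨_, rfl⟩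
  have hP0 : 0 < P := by
    rw [hP, dsum_eq_prod_one_sub_inv (h𝔴 N)]
    refine mul_pos (mul_pos hρ0 (Finset.prod_pos fun P hP => ?_)) (Real.log_pos hR1)
    have h2 : (2 : ℝ) ≤ Ideal.absNorm P := by
      exact_mod_cast two_le_absNorm_of_prime (prime_of_normalized_factor P (Multiset.mem_toFinset.1 hP))
    have : 1 / (Ideal.absNorm P : ℝ) ≤ 1 / 2 := one_div_le_one_div_of_le (by norm_num) h2
    linarith
  rw [← hP] at hcore ⊢
  rw [Real.norm_eq_abs, Real.norm_eq_abs, abs_of_pos (pow_pos hP0 k)]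
  have hLHS : ∑ 𝔲 ∈ boxG K k (𝔴 N) (R N),
      (maynardSimplex k).indicator G (fun i => Real.log (Ideal.absNorm (𝔲 i)) / Real.log (R N)) ^ 2 /
        ∏ i, idealTotient K (𝔲 i) =
      ∑ 𝔲 ∈ boxG K k (𝔴 N) (R N),
        (∏ i, 1 / idealTotient K (𝔲 i)) * H (fun i => Real.log (Ideal.absNorm (𝔲 i)) / Real.log (R N)) := by
    refine Finset.sum_congr rfl fun 𝔲 _ => ?_
    rw [hHF, Finset.prod_div_distrib, Finset.prod_const_one, one_div_mul_eq_div]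
  rw [hLHS]
  refine hcore.trans (mul_le_mul_of_nonneg_right ?_ (pow_pos hP0 k).le)
  linarith

end Literature.NumberTheory.Sieve.MaynardNF
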